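import Literature.RingTheory.Henselian.FiniteAlgebraProductOfLocalizations
import Literature.RingTheory.Idempotents.AlgHomCornerOfReduction
import Literature.RingTheory.Idempotents.FiniteAlgebraLocalFactorsRank
import Literature.RingTheory.IntegralClosure.FiniteTorsionFreeAlgebraGenericRank
import Literature.RingTheory.Valuation.IntegralPointsSpecialisationCount
import Mathlib.RingTheory.Localization.AtPrime.Basic
import Mathlib.RingTheory.Localization.Away.Lemmas
import HarnessLib

/-!
# Local factors of a finite algebra over a henselian local ring in `Localization.AtPrime` currency: points and corners
# ([Tate1997FiniteFlatGroupSchemes] (3.7); [StacksProject] Tag 04GG, 04GH)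

Topic `Literature/RingTheory/Henselian`; namespace `Literature.RingTheory.Henselian`.  PROOF FILE (theorems only; no definition,
no named fact, no instance, no notation, no `sorry`).  Cell `hodgecm-mathlib` (D-0151), FLOOR-0 P5a row G3, file (B1) of
F0P5a-plan (g5)'s G-QUEUE WORD 06:49:19Z (1): heads (a)(b) — the DICTIONARY between the `R`-points of a commutative
`R`-algebra `B` (`G(R) = (B →ₐ[R] R)` for `G = Spec B`), their reductions `𝔫_φ := ker (B →φ R → k)` (a maximal ideal of `B`,
★ `Idempotents.isMaximal_ker_residue_comp`), the LOCAL FACTORS `Localization.AtPrime 𝔫` and the CORNERS `B ⧸ (1 - e)` of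
the separating idempotents of ★ `Henselian/FiniteAlgebraProductOfLocalizations`.  The point COUNT (head (c): «the fibre of the
reduction map over a `k`-point has `rank` elements» over the valuation ring of an algebraically closed field) is ★
`Literature/RingTheory/Valuation/IntegralPointsSpecialisationCount` (`card_algHom_residue_comp_eq`, `card_algHom_eq_finrank`) in
corner currency and is NOT restated here; §2 supplies the corner ↔ localisation transport and §3 READS it in the present currency.

* §1 (any LOCAL `R`, any commutative `R`-algebra `B`, any prime `𝔫`): **`exists_algHom_localization_comp_eq_iff`** — an
  `R`-point `φ` factors through `B → B_𝔫` iff `𝔫_φ ≤ 𝔫` (for `𝔫` maximal: iff `𝔫 = 𝔫_φ`,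
  `exists_algHom_localization_comp_eq_iff_eq`), the factorisation being unique (`algHom_localization_ext`); hence
  **`bijective_comp_algebraMap_localization`**: `ψ ↦ ψ ∘ (B → B_𝔫)` is a bijection from the `R`-points of the local factor
  `B_𝔫` onto the `R`-points of `B` reducing to `𝔫` («every point factors through exactly one local factor»).
* §2 (`R` henselian, `B` module-finite): the separating idempotent at a maximal ideal EXISTS (`exists_separatingIdempotent`,
  ★ (γ1)); for any commutative `B` and a separating idempotent `e` at a maximal `𝔫` the corner IS the local factor:
  `isLocalization_quotient_span_one_sub` (★ (γ1)'s internal `key`, exported), **`exists_algEquiv_quotient_localization`**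
  (`θ : B ⧸ (1 - e) ≃ₐ[R] B_𝔫` with `θ ∘ mk = algebraMap`); consequences `finite_localization_atPrime`,
  `free_localization_atPrime` (finite free `B` over local `R`), `finrank_localization_eq_finrank_quotient`.
* §3 head (c), READ from ★ `ValuationSubring.card_algHom_residue_comp_eq`: over the valuation ring `V` of an algebraically closed
  field `Ω`, for `B` finite free with reduced generic fibre `Ω ⊗_V B` and `χ : B →ₐ[V] κ(V)` a `κ(V)`-point (`ker χ` maximal,
  `isMaximal_ker_algHom_residueField`), **`card_algHom_residue_comp_eq_finrank_localization`**:
  `#{ψ : B →ₐ[V] V ∕∕ residue ∘ ψ = χ} = rank_V B_{ker χ}` — the fibre of the reduction map over a point has as many elements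
  as the rank of the local factor there (so reduction is surjective on points, each local factor being non-zero).

HC_CM is proved only modulo the 7 printed citations until rung 0 closes; this file is generic commutative algebra and changes no count.

## References
* [Tate1997FiniteFlatGroupSchemes] J. Tate, *Finite flat group schemes*, in: Cornell–Silverman–Stevens (eds.), *Modular Forms and
  Fermat's Last Theorem* (Springer 1997), (3.7): `T = ⊔ T_i`, `T_i = Spec A_i` local, points and their reductions.
* [StacksProject] The Stacks Project, Tags 04GG, 04GH (Algebra, Lemmas 10.153.3–4).
-/

set_option autoImplicit false

noncomputable section

universe u v

open IsLocalRing

namespace Literature.RingTheory.Henselian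

/-! ## §1 Points factor through exactly one local factor -/

section Points

variable {R : Type u} [CommRing R] [IsLocalRing R] {B : Type v} [CommRing B] [Algebra R B]

/-- **An `R`-point factors through the local factor `B_𝔫` iff its reduction lies in `𝔫`**: for a prime `𝔫` of `B` and
`φ : B →ₐ[R] R`, there is `ψ : B_𝔫 →ₐ[R] R` with `ψ ∘ (B → B_𝔫) = φ` iff `𝔫_φ = ker(B →φ R → k) ≤ 𝔫` (elements outside `𝔫`
must go to units of the local ring `R`). [cite: Tate1997FiniteFlatGroupSchemes, (3.7)] [cite: StacksProject, Tag 04GH] -/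
theorem exists_algHom_localization_comp_eq_iff (𝔫 : Ideal B) [𝔫.IsPrime] (φ : B →ₐ[R] R) :
    (∃ ψ : Localization.AtPrime 𝔫 →ₐ[R] R, ψ.comp (IsScalarTower.toAlgHom R B (Localization.AtPrime 𝔫)) = φ) ↔
      RingHom.ker ((residue R).comp (φ : B →+* R)) ≤ 𝔫 := by
  constructor
  · rintro ⟨ψ, hψ⟩ b hb
    by_contra hbn
    have hunit : IsUnit (algebraMap B (Localization.AtPrime 𝔫) b) :=
      IsLocalization.map_units (Localization.AtPrime 𝔫) (⟨b, hbn⟩ : 𝔫.primeCompl)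
    have hφb : IsUnit (φ b) := by
      have := hunit.map ψ
      rwa [← IsScalarTower.coe_toAlgHom' R B (Localization.AtPrime 𝔫), ← AlgHom.comp_apply, hψ] at this
    rw [RingHom.mem_ker, RingHom.comp_apply, residue_eq_zero_iff] at hb
    exact hb hφb
  · intro h
    have hunits : ∀ y : 𝔫.primeCompl, IsUnit (φ y) := fun y => by
      by_contra hu
      have hmem : (y : B) ∈ RingHom.ker ((residue R).comp (φ : B →+* R)) := by
        rw [RingHom.mem_ker, RingHom.comp_apply, residue_eq_zero_iff]
        exact hu
      exact y.2 (h hmem)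
    refine ⟨IsLocalization.liftAlgHom (M := 𝔫.primeCompl) (f := φ) hunits, ?_⟩
    apply AlgHom.ext
    intro b
    rw [AlgHom.comp_apply, IsScalarTower.coe_toAlgHom', IsLocalization.liftAlgHom_apply, IsLocalization.lift_eq]
    rfl

omit [IsLocalRing R] in
/-- Uniqueness of the factorisation through a local factor (`B → B_𝔫` is an epimorphism). [cite: StacksProject, Tag 04GH] -/
theorem algHom_localization_ext (𝔫 : Ideal B) [𝔫.IsPrime] {C : Type*} [CommRing C] [Algebra R C]
    (ψ ψ' : Localization.AtPrime 𝔫 →ₐ[R] C)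
    (h : ψ.comp (IsScalarTower.toAlgHom R B (Localization.AtPrime 𝔫)) =
      ψ'.comp (IsScalarTower.toAlgHom R B (Localization.AtPrime 𝔫))) : ψ = ψ' := by
  apply AlgHom.coe_ringHom_injective
  refine IsLocalization.ringHom_ext 𝔫.primeCompl ?_
  have := congrArg (fun χ : B →ₐ[R] C => (χ : B →+* C)) h
  simpa [AlgHom.comp_toRingHom] using this

/-- For a MAXIMAL ideal `𝔫`: `φ` factors through `B_𝔫` iff `𝔫` IS the reduction `𝔫_φ` of `φ`.
[cite: Tate1997FiniteFlatGroupSchemes, (3.7)] -/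
theorem exists_algHom_localization_comp_eq_iff_eq (𝔫 : Ideal B) [h𝔫 : 𝔫.IsMaximal] (φ : B →ₐ[R] R) :
    (∃ ψ : Localization.AtPrime 𝔫 →ₐ[R] R, ψ.comp (IsScalarTower.toAlgHom R B (Localization.AtPrime 𝔫)) = φ) ↔
      𝔫 = RingHom.ker ((residue R).comp (φ : B →+* R)) := by
  rw [exists_algHom_localization_comp_eq_iff]
  have hmax := (Literature.RingTheory.Idempotents.isMaximal_ker_residue_comp φ).1
  constructor
  · intro h
    exact (hmax.eq_of_le h𝔫.ne_top h).symm
  · intro h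
    exact h.symm.le

/-- **Every `R`-point factors through exactly one local factor** (head (b)): `ψ ↦ ψ ∘ (B → B_𝔫)` is a BIJECTION from the
`R`-points of the local factor `B_𝔫` (`𝔫` maximal) onto the `R`-points of `B` whose reduction is `𝔫`.
[cite: Tate1997FiniteFlatGroupSchemes, (3.7)] [cite: StacksProject, Tag 04GH] -/
theorem bijective_comp_algebraMap_localization (𝔫 : Ideal B) [𝔫.IsMaximal] :
    Function.Bijective fun ψ : Localization.AtPrime 𝔫 →ₐ[R] R =>
      (⟨ψ.comp (IsScalarTower.toAlgHom R B (Localization.AtPrime 𝔫)),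
        ((exists_algHom_localization_comp_eq_iff_eq 𝔫 _).1 ⟨ψ, rfl⟩).symm⟩ :
        {φ : B →ₐ[R] R // RingHom.ker ((residue R).comp (φ : B →+* R)) = 𝔫}) := by
  constructor
  · intro ψ ψ' h
    exact algHom_localization_ext 𝔫 ψ ψ' (congrArg Subtype.val h)
  · rintro ⟨φ, hφ⟩
    obtain ⟨ψ, hψ⟩ := (exists_algHom_localization_comp_eq_iff_eq 𝔫 φ).2 hφ.symm
    exact ⟨ψ, Subtype.ext hψ⟩

end Points

/-! ## §2 Corners are local factors -/

section Corners

variable {R : Type u} [CommRing R] {B : Type v} [CommRing B] [Algebra R B]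

/-- **Existence of the separating idempotent at a maximal ideal** over a HENSELIAN local base (`B` module-finite): there is an
idempotent `e` with `e ≡ 1 (mod 𝔫)` and `e ∈ 𝔫'` for every other maximal `𝔫'` (★ (γ1)
`exists_completeOrthogonalIdempotents_maximalSpectrum`). [cite: StacksProject, Tag 04GG (1)⇒(10)] -/
theorem exists_separatingIdempotent [HenselianLocalRing R] [Module.Finite R B] (𝔫 : Ideal B) [h𝔫 : 𝔫.IsMaximal] :
    ∃ e : B, IsIdempotentElem e ∧ e - 1 ∈ 𝔫 ∧ ∀ 𝔫' : Ideal B, 𝔫'.IsMaximal → 𝔫' ≠ 𝔫 → e ∈ 𝔫' := by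
  classical
  haveI : Fintype (MaximalSpectrum B) :=
    @Fintype.ofFinite _ (Literature.RingTheory.Idempotents.finite_maximalSpectrum (R := R) (A := B))
  obtain ⟨f, hf, hf1, hf0⟩ := exists_completeOrthogonalIdempotents_maximalSpectrum R (S := B)
  exact ⟨f ⟨𝔫, h𝔫⟩, hf.idem _, hf1 ⟨𝔫, h𝔫⟩, fun 𝔫' h𝔫' hne =>
    hf0 ⟨𝔫, h𝔫⟩ ⟨𝔫', h𝔫'⟩ fun h => hne (congrArg MaximalSpectrum.asIdeal h).symm⟩

omit [Algebra R B] in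
/-- **The corner of a separating idempotent is the localisation** (★ (γ1)'s internal step, exported): for `e` idempotent with
`e ≡ 1 (mod 𝔫)`, `e ∈ 𝔫'` for all other maximal `𝔫'`, the quotient `B ⧸ (1 - e)` is a localisation of `B` at `𝔫`.
[cite: StacksProject, Tag 04GH] -/
theorem isLocalization_quotient_span_one_sub (𝔫 : Ideal B) [h𝔫 : 𝔫.IsMaximal] {e : B} (he : IsIdempotentElem e)
    (he1 : e - 1 ∈ 𝔫) (he0 : ∀ 𝔫' : Ideal B, 𝔫'.IsMaximal → 𝔫' ≠ 𝔫 → e ∈ 𝔫') :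
    IsLocalization 𝔫.primeCompl (B ⧸ Ideal.span {1 - e}) := by
  haveI : IsLocalization.Away e (B ⧸ Ideal.span {1 - e}) := IsLocalization.Away.quotient_of_isIdempotentElem he
  obtain ⟨hloc, hmax⟩ := isLocalRing_quotient_span_one_sub e 𝔫 he1 he0
  haveI := hloc
  have hne : e ∉ 𝔫 := fun hmem => h𝔫.ne_top ((Ideal.eq_top_iff_one _).2 (by
    have := 𝔫.sub_mem hmem he1; rwa [sub_sub_cancel] at this))
  refine IsLocalization.of_le (Submonoid.powers e) 𝔫.primeCompl ?_ fun r hr => ?_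
  · rw [Submonoid.powers_le]
    exact hne
  · rw [Ideal.Quotient.algebraMap_eq]
    by_contra hunit
    have hmem : Ideal.Quotient.mk (Ideal.span {1 - e}) r ∈ maximalIdeal (B ⧸ Ideal.span {1 - e}) := by
      rw [IsLocalRing.mem_maximalIdeal, mem_nonunits_iff]; exact hunit
    rw [← IsLocalRing.eq_maximalIdeal hmax, ← Ideal.mem_comap, Ideal.comap_map_of_surjective _
      Ideal.Quotient.mk_surjective, ← RingHom.ker_eq_comap_bot, Ideal.mk_ker, sup_eq_left.2 ?_] at hmem
    · exact hr hmem
    · rw [Ideal.span_le, Set.singleton_subset_iff]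
      have := 𝔫.neg_mem he1
      rwa [neg_sub] at this

/-- **Corner ≃ local factor as `R`-algebras**, compatibly with the structure maps: `θ (mk b) = algebraMap B B_𝔫 b`.
[cite: StacksProject, Tag 04GH] -/
theorem exists_algEquiv_quotient_localization (𝔫 : Ideal B) [𝔫.IsMaximal] {e : B} (he : IsIdempotentElem e)
    (he1 : e - 1 ∈ 𝔫) (he0 : ∀ 𝔫' : Ideal B, 𝔫'.IsMaximal → 𝔫' ≠ 𝔫 → e ∈ 𝔫') :
    ∃ θ : (B ⧸ Ideal.span {1 - e}) ≃ₐ[R] Localization.AtPrime 𝔫,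
      ∀ b : B, θ (Ideal.Quotient.mk (Ideal.span {1 - e}) b) = algebraMap B (Localization.AtPrime 𝔫) b := by
  haveI := isLocalization_quotient_span_one_sub 𝔫 he he1 he0
  refine ⟨(IsLocalization.algEquiv 𝔫.primeCompl (B ⧸ Ideal.span {1 - e}) (Localization.AtPrime 𝔫)).restrictScalars R,
    fun b => ?_⟩
  rw [AlgEquiv.restrictScalars_apply, ← Ideal.Quotient.algebraMap_eq, IsLocalization.algEquiv_apply,
    IsLocalization.map_eq, RingHom.id_apply]

/-- The local factor at a maximal ideal admitting a separating idempotent is module-FINITE over `R` when `B` is.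
[cite: StacksProject, Tag 04GH] -/
theorem finite_localization_atPrime [Module.Finite R B] (𝔫 : Ideal B) [𝔫.IsMaximal] {e : B} (he : IsIdempotentElem e)
    (he1 : e - 1 ∈ 𝔫) (he0 : ∀ 𝔫' : Ideal B, 𝔫'.IsMaximal → 𝔫' ≠ 𝔫 → e ∈ 𝔫') :
    Module.Finite R (Localization.AtPrime 𝔫) := by
  obtain ⟨θ, -⟩ := exists_algEquiv_quotient_localization (R := R) 𝔫 he he1 he0
  haveI := Literature.RingTheory.IntegralClosure.finite_quotient_span_one_sub (R := R) (S := B) e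
  exact Module.Finite.equiv θ.toLinearEquiv

/-- The local factor is FREE over a local `R` when `B` is finite free (★ `Idempotents.free_quotient_span_one_sub`).
[cite: StacksProject, Tag 04GH] -/
theorem free_localization_atPrime [IsLocalRing R] [Module.Finite R B] [Module.Free R B] (𝔫 : Ideal B) [𝔫.IsMaximal]
    {e : B} (he : IsIdempotentElem e) (he1 : e - 1 ∈ 𝔫) (he0 : ∀ 𝔫' : Ideal B, 𝔫'.IsMaximal → 𝔫' ≠ 𝔫 → e ∈ 𝔫') :
    Module.Free R (Localization.AtPrime 𝔫) := by
  obtain ⟨θ, -⟩ := exists_algEquiv_quotient_localization (R := R) 𝔫 he he1 he0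
  haveI := Literature.RingTheory.Idempotents.free_quotient_span_one_sub (R := R) (A := B) he
  exact Module.Free.of_equiv θ.toLinearEquiv

/-- The `R`-rank of the local factor is the `R`-rank of the corner. [cite: StacksProject, Tag 04GH] -/
theorem finrank_localization_eq_finrank_quotient (𝔫 : Ideal B) [𝔫.IsMaximal] {e : B} (he : IsIdempotentElem e)
    (he1 : e - 1 ∈ 𝔫) (he0 : ∀ 𝔫' : Ideal B, 𝔫'.IsMaximal → 𝔫' ≠ 𝔫 → e ∈ 𝔫') :
    Module.finrank R (Localization.AtPrime 𝔫) = Module.finrank R (B ⧸ Ideal.span {1 - e}) := by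
  obtain ⟨θ, -⟩ := exists_algEquiv_quotient_localization (R := R) 𝔫 he he1 he0
  exact θ.toLinearEquiv.finrank_eq.symm

end Corners

/-! ## §3 Head (c): the point count in local-factor currency (valuation ring of an algebraically closed field) -/

section Count

open scoped TensorProduct

variable {Ω : Type} [Field Ω] (V : ValuationSubring Ω) {B : Type} [CommRing B] [Algebra V B]

/-- The kernel of a `κ(V)`-valued point `χ : B →ₐ[V] κ(V)` is a maximal ideal (χ is onto the residue field).
[cite: StacksProject, Tag 04GG] -/
theorem isMaximal_ker_algHom_residueField (χ : B →ₐ[V] ResidueField V) :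
    (RingHom.ker (χ : B →+* ResidueField V)).IsMaximal :=
  RingHom.ker_isMaximal_of_surjective _ fun x => by
    obtain ⟨v, rfl⟩ := residue_surjective x
    exact ⟨algebraMap V B v, by rw [AlgHom.coe_toRingHom, AlgHom.commutes]; rfl⟩

variable [IsAlgClosed Ω] [Module.Finite V B] [Module.Free V B]

/-- **Head (c): the fibre of the reduction map over a point has `rank (local factor)` elements.**  Over the valuation ring `V`
of an algebraically closed field `Ω`, for `B` module-finite free with REDUCED generic fibre `Ω ⊗_V B` and a `κ(V)`-point
`χ : B →ₐ[V] κ(V)`: the number of `V`-points `ψ : B →ₐ[V] V` specialising to `χ` (`residue ∘ ψ = χ`) is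
`Module.finrank V (Localization.AtPrime (ker χ))`.  This is ★ `ValuationSubring.card_algHom_residue_comp_eq` (corner currency,
Hensel-free separating family ★ `ValuationSubring.exists_completeOrthogonalIdempotents_isLocalRing`) read through §2.
[cite: Tate1997FiniteFlatGroupSchemes, (3.7)] [cite: StacksProject, Tag 04GG] -/
theorem card_algHom_residue_comp_eq_finrank_localization [IsReduced (Ω ⊗[↥V] B)] (χ : B →ₐ[↥V] ResidueField ↥V) :
    haveI := isMaximal_ker_algHom_residueField V χ
    Nat.card {ψ : B →ₐ[↥V] ↥V // (residue ↥V).comp (ψ : B →+* ↥V) = (χ : B →+* ResidueField ↥V)} =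
      Module.finrank (↥V) (Localization.AtPrime (RingHom.ker (χ : B →+* ResidueField ↥V))) := by
  classical
  haveI h𝔫 := isMaximal_ker_algHom_residueField V χ
  haveI := Literature.RingTheory.Idempotents.isArtinianRing_quotient (R := ↥V) (A := B)
  haveI : Fintype (MaximalSpectrum (B ⧸ (maximalIdeal ↥V).map (algebraMap (↥V) B))) := Fintype.ofFinite _
  obtain ⟨e, he, hsep1, hsep0, -⟩ := V.exists_completeOrthogonalIdempotents_isLocalRing (A := B)
  set 𝔫 : Ideal B := RingHom.ker (χ : B →+* ResidueField ↥V) with h𝔫def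
  -- the reduction `I` of `𝔫` in `MaxSpec (B ⧸ 𝔪B)`
  let I : MaximalSpectrum (B ⧸ (maximalIdeal ↥V).map (algebraMap (↥V) B)) :=
    ⟨𝔫.map (Ideal.Quotient.mk _), Literature.RingTheory.Idempotents.isMaximal_map_mk (R := ↥V) 𝔫 h𝔫⟩
  have hI : I.asIdeal.comap (Ideal.Quotient.mk ((maximalIdeal ↥V).map (algebraMap (↥V) B))) = 𝔫 :=
    Literature.RingTheory.Idempotents.comap_map_mk (R := ↥V) 𝔫 h𝔫
  rw [ValuationSubring.card_algHom_residue_comp_eq V e he hsep1 hsep0 I χ hI.symm]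
  refine (finrank_localization_eq_finrank_quotient (R := ↥V) 𝔫 (he.idem I) ?_ fun 𝔫' h𝔫' hne => ?_).symm
  · have h1 : 1 - e I ∈ 𝔫 := hI ▸ hsep1 I
    have := 𝔫.neg_mem h1
    rwa [neg_sub] at this
  · let I' : MaximalSpectrum (B ⧸ (maximalIdeal ↥V).map (algebraMap (↥V) B)) :=
      ⟨𝔫'.map (Ideal.Quotient.mk _), Literature.RingTheory.Idempotents.isMaximal_map_mk (R := ↥V) 𝔫' h𝔫'⟩
    have hI' : I'.asIdeal.comap (Ideal.Quotient.mk ((maximalIdeal ↥V).map (algebraMap (↥V) B))) = 𝔫' :=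
      Literature.RingTheory.Idempotents.comap_map_mk (R := ↥V) 𝔫' h𝔫'
    have hne' : I ≠ I' := fun h => hne (by rw [← hI', ← h, hI])
    exact hI' ▸ hsep0 I I' hne'

end Count

end Literature.RingTheory.Henselian

end
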